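import Literature.Geometry.Kaehler.ComplexTorusHodgeGroupComplexPointsTransport
import Literature.Geometry.Kaehler.ComplexTorusHodgeGroupLieAlgebraRealForms
import HarnessLib

/-!
# The dual torus on complex points: `Hg(X̂)(ℂ) = ᵗHg(X)(ℂ)⁻¹`, `Lie Hg(X̂)(ℂ) = -ᵗLie Hg(X)(ℂ)`,
# `hodgeGroupComplexLie(X̂) = -ᵗhodgeGroupComplexLie(X)`, `dim_ℂ` and the `ℂ`-Lie isomorphism `Z ↦ -ᵗZ`

Layer `Literature/Geometry/Kaehler`, namespace `Literature.Geometry.Kaehler.ComplexTorus`; lane `lit-hodgefound` (Track 2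
foundations library), Layer A4, prover seat p17 (generation 17), self-proposed row g17-#8 — the complex-points companion
of g17-#7 `ComplexTorusDualHodgeLieAlgebra` (real points: `𝔥𝔤_ℝ(X̂) = -ᵗ𝔥𝔤_ℝ(X)` through `hodgeGroup_dual`).  Here
GGK (I.B.3) for the contragredient is run on COMPLEX points through p40's transport theorem
`IsPolyGroupIso.mem_hodgeGroupC_iff` (`ComplexTorusHodgeGroupComplexPointsTransport` §1) with the tree's
`isPolyGroupIso_contragredientMap`, `peval_contragredientMap`, `hodgeCircle_dualPeriod_eq_transpose_adjugate`,
`hodgeCircle_mem_ratZeroLocus_slEqs`, `transpose_adjugate_mul`, `transpose_adjugate_transpose_adjugate_of_det_eq_one`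
(`ComplexTorusHodgeGroupFunctoriality` §7, `ComplexTorusHodgeGroupProduct`) — exactly as the tree's
`mem_hodgeGroup_dual_iff` does on real points and `mumfordTateGroupC_dual` does for `MT` — and then differentiated on
p40's carriers `hodgeGroupLieC Φ = Lie Hg(X)(ℂ)`, `hodgeGroupComplexLie Φ` (`ComplexTorusHodgeGroupLieAlgebraCartan` /
`…RealForms`: `mem_hodgeGroupLieC_iff`, `mem_hodgeGroupComplexLie_iff_smul_mem`).  Everything consumed BY NAME;
THEOREMS ONLY (no definition, no named fact, no instance / no instance attribute), net debt 0.

## Sources, verbatim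

* [GreenGriffithsKerr2012] M. Green, P. Griffiths, M. Kerr, *Mumford–Tate Groups and Domains* (2012), §I.B (I.B.3) (held
  `book:green2012-mumford-tate-groups-domains-their-geometry-arithmetic` p0039): "`M_{ρ(φ̃)}` is the image of `M_φ̃` under
  the natural map `ρ : GL(V) → GL(V_ρ)`"; (I.B.4): "`f(Ȳ^ℚ) = \\overline{f(Y)}^ℚ`" (for `Y ⊂ X₁(ℂ)`, complex points).
* [Hall2015] B. C. Hall, GTM 222 (2015), Proposition 2.3 (held `galaxy-panama-293045618606123` p0040): "2. `(e^X)^* = e^{X^*}`.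
  3. `e^X` is invertible and `(e^X)⁻¹ = e^{-X}`"; Theorem 3.28 (3) and Exercise 8.
* [Moonen1999MTNotes] B. Moonen, *Notes on Mumford–Tate groups* (1999), (1.8) (the dual Hodge structure), as cited by the
  tree's `mumfordTateGroupC_dual`.
* [Lange2023AbelianVarietiesComplex] H. Lange (2023), §1.4.1 (`X̂`), §7.2.1.

## What is proved

* §1 `Hg(X̂)(ℂ)`: `transpose_adjugate_eq_exp_neg_transpose` (`det M = 1`, `M = e^W ⇒ ᵗadj M = e^{-ᵗW}` over `ℂ`),
  **`mem_hodgeGroupC_dual_iff`** (`N ∈ Hg(X̂)(ℂ) ⟺ N = ᵗadj M = ᵗM⁻¹` for some `M ∈ Hg(X)(ℂ)`),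
  `transpose_adjugate_mem_hodgeGroupC_dual_iff` (`ᵗM⁻¹ ∈ Hg(X̂)(ℂ) ⟺ M ∈ Hg(X)(ℂ)`), `hodgeGroupC_dual_comm_iff`.
* §2 `Lie Hg(X̂)(ℂ)`: **`neg_transpose_mem_hodgeGroupLieC_dual`**, **`mem_hodgeGroupLieC_dual_iff`**, **`coe_hodgeGroupLieC_dual`**
  (`Lie Hg(X̂)(ℂ) = -ᵗLie Hg(X)(ℂ)`), **`finrank_hodgeGroupLieC_dual`**.
* §3 `hodgeGroupComplexLie(X̂)`: `neg_transpose_mem_hodgeGroupComplexLie_dual`, **`mem_hodgeGroupComplexLie_dual_iff`**,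
  **`coe_hodgeGroupComplexLie_dual`**, **`finrank_hodgeGroupComplexLie_dual`** (`dim_ℂ`),
  **`nonempty_hodgeGroupComplexLie_dual_lieEquiv`** (`Z ↦ -ᵗZ` is a `ℂ`-Lie isomorphism).

NOT here: a bundled contragredient `SL_ι(ℂ) →* SL_ι(ℂ)` (that would be a definition; the tree's `contragredientSL` is the
real-points homomorphism, `contragredientGL` the `GL` one) — the statements are on elements and on carrier sets instead.
-/

open scoped Matrix

open Set Function Matrix Module NormedSpace

namespace Literature.Geometry.Kaehler

namespace ComplexTorus

open PolyMatrixMap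

section DualC

variable {ι : Type*} [Fintype ι] [DecidableEq ι] {E : Type*} [NormedAddCommGroup E] [NormedSpace ℂ E]
  (Φ : (ι → ℝ) ≃L[ℝ] E)

/-! ## §1 `Hg(X̂)(ℂ) = ᵗHg(X)(ℂ)⁻¹` -/

omit [DecidableEq ι] in
/-- **`ᵗadj(e^W) = e^{-ᵗW}` when `det e^W = 1`** (`adj M = M⁻¹`, `(e^W)⁻¹ = e^{-W}`, `ᵗ(e^W) = e^{ᵗW}`), over `ℂ`.
[cite: Hall2015, Proposition 2.3 (2), (3)] -/
theorem transpose_adjugate_eq_exp_neg_transpose [DecidableEq ι] {M W : Matrix ι ι ℂ} (hdet : M.det = 1)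
    (hM : M = exp W) : (M.adjugate)ᵀ = exp (-Wᵀ) := by
  have hadj : M.adjugate = M⁻¹ := by rw [Matrix.inv_def, hdet, Ring.inverse_one, one_smul]
  rw [hadj, hM, ← Matrix.exp_neg, ← Matrix.exp_transpose, Matrix.transpose_neg]

/-- **`Hg(X̂)(ℂ) = ᵗHg(X)(ℂ)⁻¹` on elements: `N ∈ Hg(X̂)(ℂ) ⟺ N = ᵗadj(M) = ᵗM⁻¹` for some `M ∈ Hg(X)(ℂ)`** — GGK
(I.B.3) for the contragredient, on COMPLEX points (p40's `IsPolyGroupIso.mem_hodgeGroupC_iff` with the tree's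
`isPolyGroupIso_contragredientMap`; the real-points form is `mem_hodgeGroup_dual_iff`, the `MT` form `mumfordTateGroupC_dual`).
[cite: GreenGriffithsKerr2012, §I.B (I.B.3), (I.B.4)] [cite: Moonen1999MTNotes, (1.8)] -/
theorem mem_hodgeGroupC_dual_iff {N : SpecialLinearGroup ι ℂ} :
    N ∈ hodgeGroupC (dualPeriod Φ) ↔ ∃ M ∈ hodgeGroupC Φ, (M.1.adjugate)ᵀ = N.1 := by
  rw [(isPolyGroupIso_contragredientMap (κ := ι)).mem_hodgeGroupC_iff (Φ := Φ) (Φ' := dualPeriod Φ)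
    (hodgeCircle_mem_ratZeroLocus_slEqs Φ)
    (fun θ ↦ by rw [peval_contragredientMap, hodgeCircle_dualPeriod_eq_transpose_adjugate])]
  refine exists_congr fun M ↦ and_congr_right fun _ ↦ ?_
  rw [peval_contragredientMap]

/-- **`ᵗadj(M) = ᵗM⁻¹ ∈ Hg(X̂)(ℂ) ⟺ M ∈ Hg(X)(ℂ)`** for `M ∈ SL_ι(ℂ)` (the contragredient is an injective involution).
[cite: GreenGriffithsKerr2012, §I.B (I.B.3)] -/
theorem transpose_adjugate_mem_hodgeGroupC_dual_iff {M : SpecialLinearGroup ι ℂ} {N : SpecialLinearGroup ι ℂ}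
    (hN : N.1 = (M.1.adjugate)ᵀ) : N ∈ hodgeGroupC (dualPeriod Φ) ↔ M ∈ hodgeGroupC Φ := by
  rw [mem_hodgeGroupC_dual_iff]
  constructor
  · rintro ⟨M', hM', hMM'⟩
    have h : M'.1 = M.1 := by
      rw [← transpose_adjugate_transpose_adjugate_of_det_eq_one M'.2, hMM', hN,
        transpose_adjugate_transpose_adjugate_of_det_eq_one M.2]
    rwa [← Subtype.ext h]
  · intro hM
    exact ⟨M, hM, hN.symm⟩

/-- **`Hg(X̂)(ℂ)` is commutative iff `Hg(X)(ℂ)` is** (complex points; compare `hodgeGroup_dual_comm_iff`,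
`IsAbelianVariety.hodgeGroupC_comm_iff_exists_comm_isReduced_le_endAlgRat`). [cite: GreenGriffithsKerr2012, §I.B (I.B.3)]
[cite: Lange2023AbelianVarietiesComplex, §7.2.3 Prop. 7.2.6] -/
theorem hodgeGroupC_dual_comm_iff :
    (∀ M ∈ hodgeGroupC (dualPeriod Φ), ∀ N ∈ hodgeGroupC (dualPeriod Φ), M * N = N * M) ↔
      ∀ M ∈ hodgeGroupC Φ, ∀ N ∈ hodgeGroupC Φ, M * N = N * M := by
  have key : ∀ {M N M' N' : SpecialLinearGroup ι ℂ}, M'.1 = (M.1.adjugate)ᵀ → N'.1 = (N.1.adjugate)ᵀ →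
      M' * N' = N' * M' → M * N = N * M := by
    intro M N M' N' hM' hN' h
    have hMN : (M.1 * N.1).det = 1 := by rw [Matrix.det_mul, M.2, N.2, mul_one]
    have hNM : (N.1 * M.1).det = 1 := by rw [Matrix.det_mul, M.2, N.2, mul_one]
    have h0 : M'.1 * N'.1 = N'.1 * M'.1 := congrArg Subtype.val h
    have h1 : ((M.1 * N.1).adjugate)ᵀ = ((N.1 * M.1).adjugate)ᵀ := by
      rw [transpose_adjugate_mul, transpose_adjugate_mul, ← hM', ← hN', h0]
    have h2 := congrArg (fun A : Matrix ι ι ℂ ↦ (A.adjugate)ᵀ) h1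
    simp only [transpose_adjugate_transpose_adjugate_of_det_eq_one hMN,
      transpose_adjugate_transpose_adjugate_of_det_eq_one hNM] at h2
    exact Subtype.ext h2
  constructor
  · intro h M hM N hN
    have hM' : (⟨(M.1.adjugate)ᵀ, by rw [det_transpose_adjugate_of_det_eq_one M.2]⟩ : SpecialLinearGroup ι ℂ) ∈
        hodgeGroupC (dualPeriod Φ) := (transpose_adjugate_mem_hodgeGroupC_dual_iff Φ rfl).2 hM
    have hN' : (⟨(N.1.adjugate)ᵀ, by rw [det_transpose_adjugate_of_det_eq_one N.2]⟩ : SpecialLinearGroup ι ℂ) ∈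
        hodgeGroupC (dualPeriod Φ) := (transpose_adjugate_mem_hodgeGroupC_dual_iff Φ rfl).2 hN
    exact key rfl rfl (h _ hM' _ hN')
  · intro h M' hM' N' hN'
    obtain ⟨M, hM, hMM'⟩ := (mem_hodgeGroupC_dual_iff Φ).1 hM'
    obtain ⟨N, hN, hNN'⟩ := (mem_hodgeGroupC_dual_iff Φ).1 hN'
    have hM'' : M.1 = (M'.1.adjugate)ᵀ := by
      rw [← hMM', transpose_adjugate_transpose_adjugate_of_det_eq_one M.2]
    have hN'' : N.1 = (N'.1.adjugate)ᵀ := by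
      rw [← hNN', transpose_adjugate_transpose_adjugate_of_det_eq_one N.2]
    exact key hM'' hN'' (h _ hM _ hN)

/-! ## §2 `Lie Hg(X̂)(ℂ) = -ᵗLie Hg(X)(ℂ)` -/

/-- **`Z ∈ Lie Hg(X)(ℂ) ⇒ -ᵗZ ∈ Lie Hg(X̂)(ℂ)`** (`e^{t(-ᵗZ)} = ᵗadj(e^{tZ})`). [cite: GreenGriffithsKerr2012, §I.B (I.B.3)]
[cite: Hall2015, Theorem 3.28 (3)] -/
theorem neg_transpose_mem_hodgeGroupLieC_dual {Z : Matrix ι ι ℂ} (hZ : Z ∈ hodgeGroupLieC Φ) :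
    -Zᵀ ∈ hodgeGroupLieC (dualPeriod Φ) := by
  rw [mem_hodgeGroupLieC_iff] at hZ ⊢
  intro t
  obtain ⟨M, hM, hMZ⟩ := hZ t
  have hdet : ((M.1.adjugate)ᵀ).det = 1 := by rw [det_transpose_adjugate_of_det_eq_one M.2]
  refine ⟨⟨(M.1.adjugate)ᵀ, hdet⟩, (transpose_adjugate_mem_hodgeGroupC_dual_iff Φ rfl).2 hM, ?_⟩
  change (M.1.adjugate)ᵀ = exp (t • -Zᵀ)
  rw [transpose_adjugate_eq_exp_neg_transpose M.2 hMZ, Matrix.transpose_smul, smul_neg]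

/-- **`W ∈ Lie Hg(X̂)(ℂ) ⟺ -ᵗW ∈ Lie Hg(X)(ℂ)`.** [cite: GreenGriffithsKerr2012, §I.B (I.B.3)] [cite: Hall2015, Theorem 3.28 (3)] -/
theorem mem_hodgeGroupLieC_dual_iff {W : Matrix ι ι ℂ} :
    W ∈ hodgeGroupLieC (dualPeriod Φ) ↔ -Wᵀ ∈ hodgeGroupLieC Φ := by
  constructor
  · intro hW
    rw [mem_hodgeGroupLieC_iff] at hW ⊢
    intro t
    obtain ⟨N, hN, hNW⟩ := hW t
    obtain ⟨M, hM, hMN⟩ := (mem_hodgeGroupC_dual_iff Φ).1 hN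
    refine ⟨M, hM, ?_⟩
    have hNdet : N.1.det = 1 := N.2
    calc (M : Matrix ι ι ℂ) = ((N.1).adjugate)ᵀ := by
          rw [← hMN, transpose_adjugate_transpose_adjugate_of_det_eq_one M.2]
      _ = exp (t • -Wᵀ) := by
          rw [transpose_adjugate_eq_exp_neg_transpose hNdet hNW, Matrix.transpose_smul, smul_neg]
  · intro hW
    have h := neg_transpose_mem_hodgeGroupLieC_dual Φ hW
    rwa [Matrix.transpose_neg, Matrix.transpose_transpose, neg_neg] at h

/-- **`Lie Hg(X̂)(ℂ) = -ᵗLie Hg(X)(ℂ)`** (as subsets of `M_ι(ℂ)`). [cite: GreenGriffithsKerr2012, §I.B (I.B.3)] [cite: Hall2015, Theorem 3.28 (3)] -/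
theorem coe_hodgeGroupLieC_dual :
    (hodgeGroupLieC (dualPeriod Φ) : Set (Matrix ι ι ℂ)) = (fun Z ↦ -Zᵀ) '' (hodgeGroupLieC Φ : Set (Matrix ι ι ℂ)) := by
  ext W
  constructor
  · intro hW
    refine ⟨-Wᵀ, (mem_hodgeGroupLieC_dual_iff Φ).1 hW, ?_⟩
    simp only [Matrix.transpose_neg, Matrix.transpose_transpose, neg_neg]
  · rintro ⟨Z, hZ, rfl⟩
    exact neg_transpose_mem_hodgeGroupLieC_dual Φ hZ

/-- **`dim_ℝ Lie Hg(X̂)(ℂ) = dim_ℝ Lie Hg(X)(ℂ)`.** [cite: GreenGriffithsKerr2012, §I.B (I.B.3)] [cite: Hall2015, Theorem 3.28 and Exercise 8] -/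
theorem finrank_hodgeGroupLieC_dual : finrank ℝ (hodgeGroupLieC (dualPeriod Φ)) = finrank ℝ (hodgeGroupLieC Φ) := by
  letI : LieRing (Matrix ι ι ℂ) := LieRing.ofAssociativeRing
  change finrank ℝ (hodgeGroupLieC (dualPeriod Φ)).toSubmodule = finrank ℝ (hodgeGroupLieC Φ).toSubmodule
  set f : Matrix ι ι ℂ ≃ₗ[ℝ] Matrix ι ι ℂ := (Matrix.transposeLinearEquiv ι ι ℝ ℂ).trans (LinearEquiv.neg ℝ) with hf
  have hfa : ∀ X, f X = -Xᵀ := fun X ↦ rfl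
  have hmap : (hodgeGroupLieC Φ).toSubmodule.map (f : Matrix ι ι ℂ →ₗ[ℝ] Matrix ι ι ℂ) =
      (hodgeGroupLieC (dualPeriod Φ)).toSubmodule := by
    ext W
    simp only [Submodule.mem_map, LieSubalgebra.mem_toSubmodule, LinearEquiv.coe_coe, hfa]
    constructor
    · rintro ⟨Z, hZ, rfl⟩
      exact neg_transpose_mem_hodgeGroupLieC_dual Φ hZ
    · intro hW
      refine ⟨-Wᵀ, (mem_hodgeGroupLieC_dual_iff Φ).1 hW, ?_⟩
      rw [Matrix.transpose_neg, Matrix.transpose_transpose, neg_neg]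
  exact ((f.submoduleMap _).trans (LinearEquiv.ofEq _ _ hmap)).finrank_eq.symm

/-! ## §3 `hodgeGroupComplexLie(X̂) = -ᵗhodgeGroupComplexLie(X)`, `dim_ℂ`, and the `ℂ`-Lie isomorphism -/

/-- **`Z ∈ hodgeGroupComplexLie(X) ⇒ -ᵗZ ∈ hodgeGroupComplexLie(X̂)`** (all complex multiples: `z • (-ᵗZ) = -ᵗ(z • Z)`).
[cite: GreenGriffithsKerr2012, §I.B (I.B.3)] [cite: Hall2015, Theorem 3.28 (3)] -/
theorem neg_transpose_mem_hodgeGroupComplexLie_dual {Z : Matrix ι ι ℂ} (hZ : Z ∈ hodgeGroupComplexLie Φ) :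
    -Zᵀ ∈ hodgeGroupComplexLie (dualPeriod Φ) := by
  rw [mem_hodgeGroupComplexLie_iff_smul_mem] at hZ ⊢
  intro z
  rw [smul_neg, ← Matrix.transpose_smul]
  exact neg_transpose_mem_hodgeGroupLieC_dual Φ (hZ z)

/-- **`W ∈ hodgeGroupComplexLie(X̂) ⟺ -ᵗW ∈ hodgeGroupComplexLie(X)`.** [cite: GreenGriffithsKerr2012, §I.B (I.B.3)] -/
theorem mem_hodgeGroupComplexLie_dual_iff {W : Matrix ι ι ℂ} :
    W ∈ hodgeGroupComplexLie (dualPeriod Φ) ↔ -Wᵀ ∈ hodgeGroupComplexLie Φ := by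
  constructor
  · intro hW
    rw [mem_hodgeGroupComplexLie_iff_smul_mem] at hW ⊢
    intro z
    rw [smul_neg, ← Matrix.transpose_smul]
    exact (mem_hodgeGroupLieC_dual_iff Φ).1 (hW z)
  · intro hW
    have h := neg_transpose_mem_hodgeGroupComplexLie_dual Φ hW
    rwa [Matrix.transpose_neg, Matrix.transpose_transpose, neg_neg] at h

/-- **`hodgeGroupComplexLie(X̂) = -ᵗhodgeGroupComplexLie(X)`** (as subsets of `M_ι(ℂ)`). [cite: GreenGriffithsKerr2012, §I.B (I.B.3)] -/
theorem coe_hodgeGroupComplexLie_dual :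
    (hodgeGroupComplexLie (dualPeriod Φ) : Set (Matrix ι ι ℂ)) =
      (fun Z ↦ -Zᵀ) '' (hodgeGroupComplexLie Φ : Set (Matrix ι ι ℂ)) := by
  ext W
  constructor
  · intro hW
    refine ⟨-Wᵀ, (mem_hodgeGroupComplexLie_dual_iff Φ).1 hW, ?_⟩
    simp only [Matrix.transpose_neg, Matrix.transpose_transpose, neg_neg]
  · rintro ⟨Z, hZ, rfl⟩
    exact neg_transpose_mem_hodgeGroupComplexLie_dual Φ hZ

/-- **`dim_ℂ hodgeGroupComplexLie(X̂) = dim_ℂ hodgeGroupComplexLie(X)`.** [cite: GreenGriffithsKerr2012, §I.B (I.B.3)]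
[cite: Hall2015, Theorem 3.28 and Exercise 8] -/
theorem finrank_hodgeGroupComplexLie_dual :
    finrank ℂ (hodgeGroupComplexLie (dualPeriod Φ)) = finrank ℂ (hodgeGroupComplexLie Φ) := by
  letI : LieRing (Matrix ι ι ℂ) := LieRing.ofAssociativeRing
  change finrank ℂ (hodgeGroupComplexLie (dualPeriod Φ)).toSubmodule = finrank ℂ (hodgeGroupComplexLie Φ).toSubmodule
  set f : Matrix ι ι ℂ ≃ₗ[ℂ] Matrix ι ι ℂ := (Matrix.transposeLinearEquiv ι ι ℂ ℂ).trans (LinearEquiv.neg ℂ) with hf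
  have hfa : ∀ X, f X = -Xᵀ := fun X ↦ rfl
  have hmap : (hodgeGroupComplexLie Φ).toSubmodule.map (f : Matrix ι ι ℂ →ₗ[ℂ] Matrix ι ι ℂ) =
      (hodgeGroupComplexLie (dualPeriod Φ)).toSubmodule := by
    ext W
    simp only [Submodule.mem_map, LieSubalgebra.mem_toSubmodule, LinearEquiv.coe_coe, hfa]
    constructor
    · rintro ⟨Z, hZ, rfl⟩
      exact neg_transpose_mem_hodgeGroupComplexLie_dual Φ hZ
    · intro hW
      refine ⟨-Wᵀ, (mem_hodgeGroupComplexLie_dual_iff Φ).1 hW, ?_⟩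
      rw [Matrix.transpose_neg, Matrix.transpose_transpose, neg_neg]
  exact ((f.submoduleMap _).trans (LinearEquiv.ofEq _ _ hmap)).finrank_eq.symm

/-- **`hodgeGroupComplexLie(X) ≃ₗ⁅ℂ⁆ hodgeGroupComplexLie(X̂)` via `Z ↦ -ᵗZ`** (a `ℂ`-Lie automorphism of `𝔤𝔩_ι(ℂ)`).
[cite: Hall2015, Theorem 3.28 (2), (3) and Exercise 8] [cite: GreenGriffithsKerr2012, §I.B (I.B.3)] -/
theorem nonempty_hodgeGroupComplexLie_dual_lieEquiv :
    Nonempty (hodgeGroupComplexLie Φ ≃ₗ⁅ℂ⁆ hodgeGroupComplexLie (dualPeriod Φ)) := by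
  letI : LieRing (Matrix ι ι ℂ) := LieRing.ofAssociativeRing
  let e : Matrix ι ι ℂ ≃ₗ⁅ℂ⁆ Matrix ι ι ℂ :=
    { (Matrix.transposeLinearEquiv ι ι ℂ ℂ).trans (LinearEquiv.neg ℂ) with
      map_lie' := fun {X Y} ↦ by
        change -(X * Y - Y * X)ᵀ = -Xᵀ * -Yᵀ - -Yᵀ * -Xᵀ
        rw [Matrix.transpose_sub, Matrix.transpose_mul, Matrix.transpose_mul, neg_sub, neg_mul_neg, neg_mul_neg] }
  have he : ∀ X, e X = -Xᵀ := fun X ↦ rfl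
  have hmap : (hodgeGroupComplexLie Φ).map (e : Matrix ι ι ℂ →ₗ⁅ℂ⁆ Matrix ι ι ℂ) = hodgeGroupComplexLie (dualPeriod Φ) := by
    ext W
    rw [LieSubalgebra.mem_map]
    constructor
    · rintro ⟨Z, hZ, rfl⟩
      exact neg_transpose_mem_hodgeGroupComplexLie_dual Φ hZ
    · intro hW
      refine ⟨-Wᵀ, (mem_hodgeGroupComplexLie_dual_iff Φ).1 hW, (he _).trans ?_⟩
      rw [Matrix.transpose_neg, Matrix.transpose_transpose, neg_neg]
  exact ⟨e.ofSubalgebras _ _ hmap⟩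

end DualC

end ComplexTorus

end Literature.Geometry.Kaehler
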